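import Literature.Probability.FitznerVanDerHofstad2017.NbwRemainderFrame
import Literature.Probability.FitznerVanDerHofstad2017.NbwLawFourier
import HarnessLib

/-!
# The N53 frame theorem for the NBW polynomials: discharge of the polynomial-family hypothesis
# (b2b-lace, LEMMAS §20 node N68c-G)

Build `lace`, packet node N68c-G (numerics seat 3).  Everything in this module is a kernel fact about
the tree's OWN objects — the Fourier-form SRW transition functions `srwP` (`SrwLawParity.lean`), the
convolution powers `convPow (srwStep d) i` of the nearest-neighbour step distribution, the
non-backtracking counts `nbwLaw d m y = |nbwWordsTo d m y|` and polynomial laws `polyLaw`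
(`NbwRemainderFrame.lean`), the NBW polynomials `nbwPoly` (`NbwLawFourier.lean`), the trail remainder
`trailRem`, the validity predicate `IsRemKernelConst` and the polynomial-kernel integral `nbwJ`
(`NbwRemainderKernel.lean`).  The statements are elementary consequences of Fourier inversion and of
the two parent modules and are tagged with the printed displays they instantiate; they are
programme-internal (a bound VARIANT, not a display of the papers) and NOT citable as literature; no
literal of any certificate is produced or consumed here.

CONTENT.  The frame theorems `isRemKernelConst_nbwJ` / `isRemKernelConst_nbwJ_single` of
`NbwRemainderFrame.lean` bound the trail remainder `((a_{c₁} ⋆ ⋯ ⋆ a_{c_n}) ⋆ τ_p^{⋆n})(x)` of a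
composition `c` by `Γ̄₂(p)ⁿ · nbwJ d n (∏ᵢ Q cᵢ)` for EVERY polynomial family `Q : ℕ → ℝ[X]` realising
the NBW counts in `x`-space, `(hQ : ∀ m y, nbwLaw d m y = polyLaw d (Q m) y)`.  This module discharges
`hQ` at the tree's NBW polynomials `P_m = nbwPoly d m` (`P_0 = 1`, `P_1 = A`, `P_2 = A² - 2d`,
`P_{m+3} = A·P_{m+2} - (2d-1)·P_{m+1}`, `A = 2dD̂(k)`):
* `srwP_eq_convPow_srwStep` — the bridge `p_i = D^{⋆i}` between the Fourier encoding
  `p_i(y) = (2π)^{-d}∫ D̂^i cos(k·y) dk` of `SrwLawParity.lean` and the convolution encoding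
  `convPow (srwStep d) i` of the route modules (Fourier inversion, `(D^{⋆i})^ = D̂^i`);
* `nbwLaw_eq_polyLaw_nbwPoly` — `b_m = polyLaw d (P_m)`, from `card_nbwWordsTo_eq_sum_coeff_srwP`
  (`b_m(y) = Σ_i [P_m]_i (2d)^i p_i(y)`, `NbwLawFourier.lean`) and the bridge;
* `cosFT_pieces_nbwLaw` — `(b_{c₁} ⋆ ⋯ ⋆ b_{c_n})^(k) = ∏ᵢ P_{cᵢ}(2dD̂(k))`;
* `isRemKernelConst_nbwJ_nbwPoly`, `isRemKernelConst_nbwJ_single_nbwPoly` — the frame theorems with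
  NO polynomial-family hypothesis: `nbwJ d n (∏ᵢ nbwPoly d cᵢ)` (x-uniform kernel, every `x`) and
  `nbwJ d n ((∏ᵢ nbwPoly d cᵢ)·X/(2d))` (the `e₁` kernel, at the unit vectors) are valid
  remainder-kernel constants — these are exactly the integrals `J_n(∏ P_{cᵢ})`, `J_n((∏ P_{cᵢ})A/(2d))`
  of which the programme's NBW-kernel remainder tables are values; unfolded forms
  `trailRem_le_nobleSup2_pow_mul_nbwJ`, `trailRem_single_le_nobleSup2_pow_mul_nbwJ`.

CONTEXT (provenance only; nothing below is used as a hypothesis).  [NoBLE17-I] = R. Fitzner,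
R. van der Hofstad, *Generalized approach to the non-backtracking lace expansion*, PTRF 169 (2017)
1041–1119, arXiv:1506.07969: §1.2.2 (the NBW two-point function
`B̂_z(k) = (1-z²)/(1+(2d-1)z²-2dzD̂(k))`, whose `zᵐ`-coefficients are the `P_m(2dD̂(k))`), §3.4
p. 1071 (`p_i = D^{⋆i}` and the evaluation of polynomial kernels from SRW tables), §5.3.2 first
display / (5.25) p. 1097 (the printed remainder bound `(2d)^M Γ̄₂ⁿ K_{n,M}` that the N53 variant
sharpens by `a_m ≤ b_m`).  [FvdH17] = R. Fitzner, R. van der Hofstad, EJP 22 (2017) no. 43,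
arXiv:1506.07977, §4.2 (4.9)–(4.11) is the percolation instance.  [MS93] = N. Madras, G. Slade,
*The Self-Avoiding Walk* (1993), Cor. 5.3.2 (5.3.3) p. 134 (the NBW generating function).
[HvdH17] = M. Heydenreich, R. van der Hofstad, *Progress in high-dimensional percolation and random
graphs* (2017), (1.2.16)–(1.2.17) (Fourier inversion on `[-π,π]^d`).
-/
noncomputable section

namespace Literature.Probability.FitznerVanDerHofstad2017

open MeasureTheory Real Finset Filter
open scoped BigOperators
open Literature.Probability.LatticeModels
open Literature.Probability.Percolation
open Literature.Barriers.CriticalPhenomena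
open Literature.Barriers.CriticalPhenomena.SpreadOutIsing (delta0 latticeConv convPow)
open Literature.Barriers.CriticalPhenomena.Slade2006Prop53 (P)

variable {d : ℕ}

/-! ### The two encodings of the `i`-step transition function agree -/

/-- **Bridge**: the Fourier-form `i`-step transition function `p_i(y) = (2π)^{-d}∫ D̂(k)^i cos(k·y) dk`
(`srwP`, [NoBLE17] §3.4) IS the `i`-th convolution power `D^{⋆i}(y)` of the nearest-neighbour step
distribution (`convPow (srwStep d) i`): Fourier inversion applied to `(D^{⋆i})^ = D̂^i`.
[cite: FitznerVanDerHofstad2016NoBLE, §3.4 p. 1071 (p_i = D^{*i})]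
[cite: HeydenreichVanDerHofstad2017, (1.2.16)–(1.2.17)] -/
theorem srwP_eq_convPow_srwStep (hd : 1 ≤ d) (i : ℕ) (y : Site d) :
    srwP d i y = convPow (srwStep d) i y := by
  have hpi : (0 : ℝ) < (2 * π) ^ d := by positivity
  have h := integral_cube_cos_kdot_mul_cosFT (summable_convPow_srwStep i) (convPow_srwStep_neg i) y
  rw [volume_restrict_cube_eq_P] at h
  simp_rw [cosFT_convPow_srwStep hd i] at h
  unfold srwP
  rw [show (fun k => Dhat d k ^ i * Real.cos (kdot k y)) = fun k => Real.cos (kdot k y) * Dhat d k ^ i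
    from funext fun k => mul_comm _ _, h]
  field_simp

/-! ### The NBW counts are the `x`-space laws of the NBW polynomials -/

/-- **`b_m = polyLaw d (P_m)`**: the non-backtracking count `b_m(y) = |nbwWordsTo d m y|` is the
`x`-space law `Σ_i [P_m]_i (2d)^i D^{⋆i}(y)` of the NBW polynomial `P_m = nbwPoly d m`
(`b̂_m(k) = P_m(2dD̂(k))`, [NoBLE17] §1.2.2) — the tree's `card_nbwWordsTo_eq_sum_coeff_srwP`
with `p_i = D^{⋆i}`.  This discharges the polynomial-family hypothesis of the frame theorems
`isRemKernelConst_nbwJ` / `isRemKernelConst_nbwJ_single`.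
[cite: FitznerVanDerHofstad2016NoBLE, §1.2.2 (B̂_z(k) = (1-z²)/(1+(2d-1)z²-2dzD̂(k)); arXiv:1506.07969 TeX l.904–908)]
[cite: MadrasSlade1993, Cor. 5.3.2 (5.3.3) p. 134] -/
theorem nbwLaw_eq_polyLaw_nbwPoly (hd : 1 ≤ d) (m : ℕ) (y : Site d) :
    nbwLaw d m y = polyLaw d (nbwPoly d m) y := by
  unfold nbwLaw polyLaw
  rw [card_nbwWordsTo_eq_sum_coeff_srwP]
  exact Finset.sum_congr rfl fun i _ => by rw [srwP_eq_convPow_srwStep hd i y]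

/-- The family form of the discharge: `∀ m y, b_m(y) = polyLaw d (P_m)(y)`. [folklore] -/
theorem nbwLaw_eq_polyLaw_nbwPoly' (hd : 1 ≤ d) :
    ∀ (m : ℕ) (y : Site d), nbwLaw d m y = polyLaw d (nbwPoly d m) y :=
  fun m y => nbwLaw_eq_polyLaw_nbwPoly hd m y

/-- `(b_{c₁} ⋆ ⋯ ⋆ b_{c_n})^(k) = ∏ᵢ P_{cᵢ}(2dD̂(k))` for the NBW polynomials.
[cite: FitznerVanDerHofstad2016NoBLE, §1.2.2 (1.21) (arXiv numbering)] -/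
theorem cosFT_pieces_nbwLaw (hd : 1 ≤ d) (c : List ℕ) (k : Fin d → ℝ) :
    cosFT (pieces (nbwLaw d) c) k = ((c.map (nbwPoly d)).prod).eval (2 * (d : ℝ) * Dhat d k) :=
  cosFT_pieces_nbwLaw_of (nbwPoly d) (nbwLaw_eq_polyLaw_nbwPoly' hd) hd c k

/-! ### The N53 frame theorems for the NBW polynomials, hypothesis-free -/

/-- **N53 frame theorem, x-uniform kernel, for the NBW polynomials**: for every composition `c` with
`2|c| + 1 ≤ d`, `d ≥ 2`: `J_{|c|}(∏ᵢ P_{cᵢ}) = nbwJ d |c| (∏ᵢ nbwPoly d cᵢ)` is a valid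
remainder-kernel constant for `c` on all of `ℤ^d`, i.e. for every `p < p_c(ℤ^d)` and every `x`,
`((a_{c₁} ⋆ ⋯ ⋆ a_{c_n}) ⋆ τ_p^{⋆n})(x) ≤ Γ̄₂(p)ⁿ · ∫ |∏ᵢ P_{cᵢ}(2dD̂)| Ĉⁿ dk/(2π)^d` — the quantity
whose values are the programme's NBW-kernel remainder tables (uniform kernel).  Programme-internal
bound VARIANT of [NoBLE17] (5.25) line 3 / §5.3.2 first display (trails ≤ non-backtracking walks in
place of trails ≤ all walks); not a display of the papers.
[cite: FitznerVanDerHofstad2016NoBLE, §5.3.2 (first display) p. 1097; (5.25) p. 1097] -/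
theorem isRemKernelConst_nbwJ_nbwPoly (c : List ℕ) (hn : 2 * c.length + 1 ≤ d) (hd : 2 ≤ d) :
    IsRemKernelConst d c Set.univ (nbwJ d c.length (c.map (nbwPoly d)).prod) :=
  isRemKernelConst_nbwJ (nbwPoly d) c hn hd (nbwLaw_eq_polyLaw_nbwPoly' (by omega))

/-- **N53 frame theorem, `e₁` kernel, for the NBW polynomials**: at the unit vectors `x = eᵢ`,
`J_{|c|}((∏ᵢ P_{cᵢ})·X/(2d))` is a valid remainder-kernel constant (`D̂^{(eᵢ)} = D̂`).
[cite: FitznerVanDerHofstad2016NoBLE, §5.3.2 (first display) p. 1097; (3.34) p. 1071] -/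
theorem isRemKernelConst_nbwJ_single_nbwPoly (c : List ℕ) (hn : 2 * c.length + 1 ≤ d) (hd : 2 ≤ d) :
    IsRemKernelConst d c (Set.range fun i : Fin d => (Pi.single i (1 : ℤ) : Site d))
      (nbwJ d c.length ((c.map (nbwPoly d)).prod * Polynomial.C (1 / (2 * (d : ℝ))) * Polynomial.X)) :=
  isRemKernelConst_nbwJ_single (nbwPoly d) c hn hd (nbwLaw_eq_polyLaw_nbwPoly' (by omega))

/-- The x-uniform frame bound unfolded: for every composition `c` (`n = |c|`, `2n+1 ≤ d`, `d ≥ 2`),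
every `p < p_c(ℤ^d)` and every `x ∈ ℤ^d`,
`trailRem d p c x ≤ Γ̄₂(p)ⁿ · nbwJ d n (∏ᵢ nbwPoly d cᵢ)`.
[cite: FitznerVanDerHofstad2016NoBLE, §5.3.2 (first display) p. 1097; (5.25) p. 1097] -/
theorem trailRem_le_nobleSup2_pow_mul_nbwJ (c : List ℕ) (hn : 2 * c.length + 1 ≤ d) (hd : 2 ≤ d)
    (p : unitInterval) (hp : p < criticalProbI d) (x : Site d) :
    trailRem d p c x ≤ nobleSup2 d p ^ c.length * nbwJ d c.length (c.map (nbwPoly d)).prod :=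
  isRemKernelConst_nbwJ_nbwPoly c hn hd p hp x (Set.mem_univ x)

/-- The `e₁`-kernel frame bound unfolded, at `x = eᵢ`.
[cite: FitznerVanDerHofstad2016NoBLE, §5.3.2 (first display) p. 1097; (3.34) p. 1071] -/
theorem trailRem_single_le_nobleSup2_pow_mul_nbwJ (c : List ℕ) (hn : 2 * c.length + 1 ≤ d)
    (hd : 2 ≤ d) (p : unitInterval) (hp : p < criticalProbI d) (i : Fin d) :
    trailRem d p c (Pi.single i 1) ≤ nobleSup2 d p ^ c.length *
      nbwJ d c.length ((c.map (nbwPoly d)).prod * Polynomial.C (1 / (2 * (d : ℝ))) * Polynomial.X) :=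
  isRemKernelConst_nbwJ_single_nbwPoly c hn hd p hp (Pi.single i 1) ⟨i, rfl⟩


end Literature.Probability.FitznerVanDerHofstad2017

end
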